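/-
Copyright: the b2b-balaban T⁴-continuum CRUX team, row NE7b leaf lineage `t4-ne7b-formalise-leaf-04` (gen 150). Project licence.
-/
import Literature.Analysis.Convex.ProximalMap
import Mathlib.Analysis.Calculus.Gradient.Basic
import Mathlib.Analysis.Calculus.FDeriv.OfCompLeft
import Mathlib.Analysis.Calculus.ContDiff.Operations
import Mathlib.Analysis.InnerProductSpace.Calculus
import Mathlib.Topology.Algebra.Module.FiniteDimension

/-!
# THE BACKGROUND FIELD OF THE SOFT STEP IS `C¹` IN THE KEPT VARIABLE WITH JACOBIAN `(1 + D∇f)⁻¹`, and the next action's Hessian is the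
# RENORMALISED ONE `1 − (1 + D∇f(p))⁻¹ = D∇f(p)(1 + D∇f(p))⁻¹` — the proximal point of a `C²` convex `f` through the inverse function
# theorem, in OPERATOR currency: Jacobian norm `≤ 1` (`≤ (1+m)⁻¹` for `m`-strongly monotone `∇f`), renormalised Hessian between
# `m∕(1+m)` and `1` as a form — RESISTANCES ADD for operators; `f ∈ C^{k+1} ⟹ prox f ∈ Cᵏ` (`k ≥ 1`)
# (row NE7b, node U5c; residual (R2′) family (2), a CLASSICAL (minimisation) step; [folklore] convex analysis + the inverse function theorem)

Cell `pub-balaban`, sub-cell `t4`, spine estimate NE7b (`T4WeightBudget.RelWeightBound`; the cell's OWN estimate — NOT PRINTED in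
[Bałaban 1983–89], NOT PROVED).  Crux-route work under `Spine/NE7b/` by leaf-04 on the convexity road; NOTHING of Bałaban's is named or
asserted; no `T4Continuum/Support` leaf typed; no `def`; zero `sorry`.  Imports: the tree's BUILT `Literature.Analysis.Convex.ProximalMap`
(Moreau's `prox`, the resolvent inclusion, non-expansiveness) + Mathlib (gradient, `HasFDerivAt.of_local_left_inverse`,
`Homeomorph.contDiff_symm`, finite-dimensional linear algebra) — independent of the `Spine/NE7b` olean frontier; in particular this file
does NOT import or restate the sibling `…MoreauEnvelopeLetters` (p378204; its `∇e_f = id − prox f` identifies §6's map as the envelope's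
gradient — a pointer, not a dependency).

WHY.  `…MoreauEnvelopeLetters` (this lineage) typed the soft step's letters in FIRST-ORDER currency from `f`'s convexity alone (Moreau's
theorem, `1`-Lipschitz gradient, modulus `m∕(1+m)`, growth `½`, minimiser a `(1+m)⁻¹`-contraction) and left «`C¹` dependence of the
MINIMISER `prox f x` on `x` for `f ∈ C²` via the inverse function theorem» NOT-HERE.  The road's minimiser-adapted charts
(`…HessianChartTransport`: the chart is built from the background field, its letters need `Dφ`, `D²φ`) and the classical covariance
formula want exactly that: when the fine action is `C²`, the background field `p(x) = prox f x` (the minimiser of `z ↦ f z + ½‖z − x‖²`)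
solves `p + ∇f(p) = x`, the map `z ↦ z + ∇f z` is a `C¹` bijection whose derivative `1 + D∇f(z)` is bounded below by `1` as a form
(monotone gradient), hence invertible in finite dimension, so `p` is `C¹` with `Dp(x) = (1 + D∇f(p))⁻¹` (`‖Dp‖ ≤ 1`, `≤ (1+m)⁻¹` under
`m`-strong monotonicity), `f ∈ C^{n+1} ⟹ p ∈ Cⁿ`, and the derivative of `x ↦ x − p(x)` — the envelope's gradient — is the RENORMALISED
HESSIAN `1 − (1 + D∇f(p))⁻¹ = D∇f(p)∘(1 + D∇f(p))⁻¹`, squeezed as a form between `m∕(1+m)` and `1` WITHOUT any symmetry assumption on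
`D∇f` — resistances add at operator level (`(D²e_f)⁻¹ = (D∇f)⁻¹ + 1` when `D∇f(p)` is invertible).

WHAT IS PROVED ([folklore]; Moreau 1965, Rockafellar–Wets Thm 2.26 ∕ Ex. 12.23, Bauschke–Combettes Prop. 12.29 with the smooth inverse
function theorem; `E` a finite-dimensional real inner product space, `f : E → ℝ` `ConvexOn ℝ univ`):
* §1 GRADIENT CURRENCY FOR THE PROXIMAL POINT (`f` differentiable where stated): `hasSubgradientWithinAt_gradient`, **`prox_add_gradient`**
  (`prox f (z + ∇f z) = z`), **`gradient_prox`** (`∇f (prox f x) = x − prox f x` — the resolvent inclusion is an equation),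
  `prox_add_gradient_prox` (`prox f x + ∇f (prox f x) = x`), `prox_eq_iff_add_gradient`.
* §2 MONOTONE GRADIENT ⟹ POSITIVE DERIVATIVE: `inner_gradient_sub_nonneg` (`0 ≤ ⟪∇f x − ∇f y, x − y⟫`), **`inner_fderivGradient_self_nonneg`**
  (`HasFDerivAt (∇f) A z ⟹ 0 ≤ ⟪A v, v⟫` — slope limit along `z + tv`), `inner_fderivGradient_self_ge_of_strong` (`m‖v‖² ≤ ⟪A v, v⟫` when
  `∇f` is `m`-strongly monotone: `m‖x − y‖² ≤ ⟪∇f x − ∇f y, x − y⟫`).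
* §3 THE JACOBIAN OF `z ↦ z + ∇f z` IS INVERTIBLE (finite dimension): **`exists_equiv_of_inner_self_ge`** (`T : E →L E` with
  `c‖v‖² ≤ ⟪T v, v⟫`, `0 < c` ⟹ `∃ L : E ≃L E, ↑L = T ∧ ∀ w, ‖L.symm w‖ ≤ c⁻¹‖w‖`), `exists_equiv_id_add` (`0 ≤ ⟪A v, v⟫ ⟹` the same for
  `T = 1 + A`, `c = 1`), `exists_equiv_id_add_of_strong` (`c = 1 + m`).
* §4 **`hasFDerivAt_prox`** — `f` convex differentiable, `HasFDerivAt (∇f) A (prox f x)`, `↑L = 1 + A` ⟹ `HasFDerivAt (prox f) L.symm x`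
  (Mathlib's `HasFDerivAt.of_local_left_inverse` with the global left inverse `prox f (z + ∇f z) = z` and the continuity of `prox`);
  **`exists_hasFDerivAt_prox`** (the equiv packaged: `∃ L, ↑L = 1 + A ∧ HasFDerivAt (prox f) L.symm x ∧ ∀ w, ‖L.symm w‖ ≤ ‖w‖`),
  `norm_fderiv_prox_le_one`, `norm_fderiv_prox_le_of_strong` (`‖D prox(x)‖ ≤ (1+m)⁻¹`).
* §5 SMOOTHNESS: **`contDiff_prox`** (`ContDiff ℝ (n+2) f ⟹ ContDiff ℝ (n+1) (prox f)`, every `n : ℕ∞` — i.e. `f ∈ C^{k+1} ⟹ prox f ∈ Cᵏ` for `k ≥ 1`; `z ↦ z + ∇f z` and `prox f` are the two halves of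
  a homeomorphism of `E`; `Homeomorph.contDiff_symm`), `contDiff_id_sub_prox` (the envelope's gradient map `x ↦ x − prox f x` is `C^{n+1}`).
* §6 THE RENORMALISED HESSIAN IN OPERATOR CURRENCY: `id_sub_symm_eq_comp` (`1 − L⁻¹ = A ∘ L⁻¹` for `↑L = 1 + A`), `hasFDerivAt_id_sub_prox`
  (`D(id − prox f)(x) = 1 − L⁻¹`), **`inner_id_sub_symm_self_le`** (`⟪(1 − L⁻¹)w, w⟫ ≤ ‖w‖²`) and **`inner_id_sub_symm_self_ge`**
  (`(m∕(1+m))‖w‖² ≤ ⟪(1 − L⁻¹)w, w⟫` from `m‖v‖² ≤ ⟪A v, v⟫`, `0 ≤ m`, NO symmetry of `A` asked: with `w = v + Av`, `s = ⟪Av,v⟫∕‖v‖² ≥ m`,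
  the claim is `(s − m)(s + 1) ≥ 0` after Cauchy–Schwarz) — the form bounds `[m∕(1+m), 1]` of the next action's Hessian, matching the
  sibling's first-order letters (modulus `m∕(1+m)`, growth `½·‖·‖²`).
* §7 toy: `f = 0` — `∇f = 0`, `A = 0`, `L = 1`, `prox 0 = id` has derivative `1` (the hypotheses are inhabited; `exists_hasFDerivAt_prox` fires).

NOT HERE (honest): symmetry of `D∇f` (Schwarz) and the spectral form of §6; the weight-`a` ∕ operator-`P` bookkeeping of the averaging
step; windows (`f = +∞` off a convex set); second derivatives of `prox` (`f ∈ C³`: formula `−L⁻¹∘D²∇f(p)[L⁻¹·, L⁻¹·]` — the chart term of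
`…HessianChartTransport`, typed when a consumer names it); which of print's steps are soft classical steps ((A3) ∕ (A1c) — NC-NE7b-α
UNRULED); anything of Bałaban's.  BY-NAME EFFECT ON THE WALL: NONE.  NE7b NOT PRINTED ∕ NOT PROVED; spine PROVED 0∕9; rung (B)+1 on a FINITE
torus — NOT infinite volume, NOT the mass gap, NOT Clay.  HONEST DEPENDENCY: continuum YM on T⁴ ⇐ BetaPertH ∧ nine spine estimates (0/9
proved); BetaPertH ⇐ (D1) ∧ (D4) ∧ CAP+tail; G-an2-4 gates asym, D1 and NE2∕3∕4.
-/

set_option autoImplicit false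

noncomputable section

namespace Summit.QuantumFields.BalabanUV.T4Continuum.NE7b.MoreauProxJacobian

open Set Filter Topology InnerProductSpace
open scoped RealInnerProductSpace Gradient
open Literature.Analysis.Convex

variable {E : Type*} [NormedAddCommGroup E] [InnerProductSpace ℝ E] [FiniteDimensional ℝ E]
variable {f : E → ℝ}

/-! ## §1 Gradient currency for the proximal point -/

omit [FiniteDimensional ℝ E] in
/-- For a convex `f` differentiable at `z`, the gradient is a subgradient: `∇f z ∈ ∂f(z)` (the tree's
`ConvexOn.hasSubgradientWithinAt_of_hasFDerivAt`, read through Mathlib's `gradient = toDual.symm ∘ fderiv`). [folklore] -/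
theorem hasSubgradientWithinAt_gradient [CompleteSpace E] (hf : ConvexOn ℝ univ f) {z : E} (hd : DifferentiableAt ℝ f z) :
    HasSubgradientWithinAt f univ (∇ f z) z :=
  hf.hasSubgradientWithinAt_of_hasFDerivAt (mem_univ z) hd.hasFDerivAt

/-- **`prox f (z + ∇f z) = z`**: the proximal map is a LEFT INVERSE of `z ↦ z + ∇f z` (surjectivity of `prox` through the gradient).
[folklore] -/
theorem prox_add_gradient (hf : ConvexOn ℝ univ f) {z : E} (hd : DifferentiableAt ℝ f z) : prox f (z + ∇ f z) = z :=
  prox_add_of_hasSubgradientWithinAt hf (hasSubgradientWithinAt_gradient hf hd)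

/-- **THE RESOLVENT INCLUSION IS AN EQUATION**: if `f` is differentiable at `prox f x` then `∇f (prox f x) = x − prox f x` (uniqueness
of the subgradient at a point of differentiability, the tree's `HasSubgradientWithinAt.inner_eq_of_hasFDerivAt`). [folklore] -/
theorem gradient_prox (hf : ConvexOn ℝ univ f) {x : E} (hd : DifferentiableAt ℝ f (prox f x)) :
    ∇ f (prox f x) = x - prox f x := by
  have hsub := hasSubgradientWithinAt_prox hf x
  have huniq : ∀ v : E, ⟪x - prox f x, v⟫ = fderiv ℝ f (prox f x) v :=
    fun v => hsub.inner_eq_of_hasFDerivAt univ_mem hd.hasFDerivAt v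
  refine ext_inner_right ℝ fun v => ?_
  rw [huniq v, gradient, toDual_symm_apply]

/-- `prox f x + ∇f (prox f x) = x`: the proximal map is a RIGHT INVERSE of `z ↦ z + ∇f z`. [folklore] -/
theorem prox_add_gradient_prox (hf : ConvexOn ℝ univ f) {x : E} (hd : DifferentiableAt ℝ f (prox f x)) :
    prox f x + ∇ f (prox f x) = x := by
  rw [gradient_prox hf hd, add_sub_cancel]

/-- `prox f x = p ↔ p + ∇f p = x` for a differentiable convex `f`. [folklore] -/
theorem prox_eq_iff_add_gradient (hf : ConvexOn ℝ univ f) (hd : Differentiable ℝ f) {x p : E} :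
    prox f x = p ↔ p + ∇ f p = x := by
  constructor
  · rintro rfl; exact prox_add_gradient_prox hf (hd _)
  · rintro rfl; exact prox_add_gradient hf (hd _)

/-! ## §2 Monotone gradient ⟹ the derivative of the gradient is a positive form -/

omit [FiniteDimensional ℝ E] in
/-- **THE GRADIENT OF A CONVEX FUNCTION IS MONOTONE**: `0 ≤ ⟪∇f x − ∇f y, x − y⟫` (monotonicity of the subdifferential). [folklore] -/
theorem inner_gradient_sub_nonneg [CompleteSpace E] (hf : ConvexOn ℝ univ f) {x y : E} (hx : DifferentiableAt ℝ f x)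
    (hy : DifferentiableAt ℝ f y) : 0 ≤ ⟪∇ f x - ∇ f y, x - y⟫ :=
  (hasSubgradientWithinAt_gradient hf hx).inner_sub_nonneg (hasSubgradientWithinAt_gradient hf hy) (mem_univ _) (mem_univ _)

omit [FiniteDimensional ℝ E] in
/-- **A MONOTONE MAP HAS A POSITIVE DERIVATIVE**: if `G : E → E` satisfies `m‖x − y‖² ≤ ⟪G x − G y, x − y⟫` for all `x, y` and
`HasFDerivAt G A z`, then `m‖v‖² ≤ ⟪A v, v⟫` for every `v` (the slope of `t ↦ ⟪G(z + tv), v⟫` at `0⁺`). [folklore] -/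
theorem inner_fderiv_self_ge_of_monotone {G : E → E} {m : ℝ} (hG : ∀ x y : E, m * ‖x - y‖ ^ 2 ≤ ⟪G x - G y, x - y⟫) {z : E}
    {A : E →L[ℝ] E} (hA : HasFDerivAt G A z) (v : E) : m * ‖v‖ ^ 2 ≤ ⟪A v, v⟫ := by
  -- the scalar function `φ t = ⟪G (z + t • v), v⟫` has derivative `⟪A v, v⟫` at `0`
  have hline : HasDerivAt (fun t : ℝ => z + t • v) v 0 := by
    simpa using ((hasDerivAt_id (0 : ℝ)).smul_const v).const_add z
  have hA0 : HasFDerivAt G A (z + (0 : ℝ) • v) := by simpa using hA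
  have hh : HasDerivAt (fun t : ℝ => G (z + t • v)) (A v) 0 := hA0.comp_hasDerivAt 0 hline
  have hφ : HasDerivAt (fun t : ℝ => ⟪G (z + t • v), v⟫) ⟪A v, v⟫ 0 := by
    have h := hh.inner ℝ (hasDerivAt_const (0 : ℝ) v)
    simpa using h
  -- its right slopes are `≥ m‖v‖²`
  have hslope : ∀ t ∈ Ioi (0 : ℝ), m * ‖v‖ ^ 2 ≤ t⁻¹ • (⟪G (z + (0 + t) • v), v⟫ - ⟪G (z + (0 : ℝ) • v), v⟫) := by
    intro t ht
    have ht0 : (0 : ℝ) < t := ht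
    have hmono := hG (z + t • v) z
    rw [show z + t • v - z = t • v by abel, norm_smul, Real.norm_eq_abs, abs_of_pos ht0, inner_smul_right] at hmono
    rw [zero_add, zero_smul, add_zero, smul_eq_mul, ← inner_sub_left]
    rw [mul_pow] at hmono
    -- `hmono : m * (t² ‖v‖²) ≤ t * ⟪G(z + t v) − G z, v⟫`
    have h1 : m * ‖v‖ ^ 2 * t ≤ ⟪G (z + t • v) - G z, v⟫ := by
      have := hmono
      nlinarith
    rw [← div_eq_inv_mul, le_div_iff₀ ht0]
    exact h1
  have htend : Tendsto (fun t : ℝ => t⁻¹ • (⟪G (z + (0 + t) • v), v⟫ - ⟪G (z + (0 : ℝ) • v), v⟫)) (𝓝[>] 0) (𝓝 ⟪A v, v⟫) :=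
    hφ.tendsto_slope_zero_right
  exact ge_of_tendsto htend (eventually_nhdsWithin_of_forall hslope)

omit [FiniteDimensional ℝ E] in
/-- **THE DERIVATIVE OF A CONVEX GRADIENT IS A POSITIVE FORM**: `f` convex and differentiable, `HasFDerivAt (∇f) A z` ⟹ `0 ≤ ⟪A v, v⟫`
(no symmetry of `A` is claimed or needed). [folklore] -/
theorem inner_fderivGradient_self_nonneg [CompleteSpace E] (hf : ConvexOn ℝ univ f) (hd : Differentiable ℝ f) {z : E}
    {A : E →L[ℝ] E} (hA : HasFDerivAt (∇ f) A z) (v : E) : 0 ≤ ⟪A v, v⟫ := by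
  have h := inner_fderiv_self_ge_of_monotone (G := ∇ f) (m := 0)
    (fun x y => by rw [zero_mul]; exact inner_gradient_sub_nonneg hf (hd x) (hd y)) hA v
  simpa using h

/-! ## §3 A form-coercive endomorphism of a finite-dimensional space is an equivalence with inverse bounded by `c⁻¹` -/

/-- **`c‖v‖² ≤ ⟪T v, v⟫` WITH `0 < c` ⟹ `T` IS INVERTIBLE AND `‖T⁻¹ w‖ ≤ c⁻¹‖w‖** (finite dimension: injective ⟹ bijective; the inverse
packaged as a `ContinuousLinearEquiv` whose coercion IS `T`). [folklore] -/
theorem exists_equiv_of_inner_self_ge (T : E →L[ℝ] E) {c : ℝ} (hc : 0 < c) (hT : ∀ v : E, c * ‖v‖ ^ 2 ≤ ⟪T v, v⟫) :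
    ∃ L : E ≃L[ℝ] E, (L : E →L[ℝ] E) = T ∧ ∀ w : E, ‖L.symm w‖ ≤ c⁻¹ * ‖w‖ := by
  -- `‖T v‖ ≥ c‖v‖`
  have hlow : ∀ v : E, c * ‖v‖ ≤ ‖T v‖ := by
    intro v
    have h1 := hT v
    have h2 : ⟪T v, v⟫ ≤ ‖T v‖ * ‖v‖ := real_inner_le_norm _ _
    by_cases hv : v = 0
    · simp [hv]
    · have hvpos : 0 < ‖v‖ := norm_pos_iff.mpr hv
      nlinarith
  have hinj : Function.Injective (T : E →ₗ[ℝ] E) := by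
    rw [← LinearMap.ker_eq_bot, LinearMap.ker_eq_bot']
    intro v hv
    have h := hlow v
    have hTv : ‖T v‖ = 0 := by
      have : (T : E →ₗ[ℝ] E) v = T v := rfl
      rw [← this, hv, norm_zero]
    rw [hTv] at h
    have : ‖v‖ ≤ 0 := by nlinarith
    exact norm_le_zero_iff.mp this
  have hbij : Function.Bijective (T : E →ₗ[ℝ] E) := ⟨hinj, LinearMap.injective_iff_surjective.mp hinj⟩
  set Lₗ : E ≃ₗ[ℝ] E := LinearEquiv.ofBijective (T : E →ₗ[ℝ] E) hbij with hLₗ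
  refine ⟨Lₗ.toContinuousLinearEquiv, ?_, fun w => ?_⟩
  · ext v; rfl
  · set v := Lₗ.toContinuousLinearEquiv.symm w with hv
    have hTv : T v = w := by
      have h1 : Lₗ.toContinuousLinearEquiv v = w := by rw [hv]; exact ContinuousLinearEquiv.apply_symm_apply _ w
      exact h1
    have h := hlow v
    rw [hTv] at h
    rw [← div_eq_inv_mul, le_div_iff₀ hc]
    linarith

/-- **`1 + A` IS INVERTIBLE WITH `‖(1 + A)⁻¹‖ ≤ 1` WHEN `A` IS A POSITIVE FORM.** [folklore] -/
theorem exists_equiv_id_add (A : E →L[ℝ] E) (hA : ∀ v : E, 0 ≤ ⟪A v, v⟫) :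
    ∃ L : E ≃L[ℝ] E, (L : E →L[ℝ] E) = ContinuousLinearMap.id ℝ E + A ∧ ∀ w : E, ‖L.symm w‖ ≤ ‖w‖ := by
  obtain ⟨L, hL, hn⟩ := exists_equiv_of_inner_self_ge (ContinuousLinearMap.id ℝ E + A) one_pos fun v => by
    rw [add_apply, ContinuousLinearMap.id_apply, inner_add_left, real_inner_self_eq_norm_sq]
    linarith [hA v]
  exact ⟨L, hL, fun w => by simpa using hn w⟩

/-- **`1 + A` IS INVERTIBLE WITH `‖(1 + A)⁻¹‖ ≤ (1+m)⁻¹` WHEN `m‖v‖² ≤ ⟪A v, v⟫`, `0 ≤ m`.** [folklore] -/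
theorem exists_equiv_id_add_of_strong (A : E →L[ℝ] E) {m : ℝ} (hm : 0 ≤ m) (hA : ∀ v : E, m * ‖v‖ ^ 2 ≤ ⟪A v, v⟫) :
    ∃ L : E ≃L[ℝ] E, (L : E →L[ℝ] E) = ContinuousLinearMap.id ℝ E + A ∧ ∀ w : E, ‖L.symm w‖ ≤ (1 + m)⁻¹ * ‖w‖ :=
  exists_equiv_of_inner_self_ge (ContinuousLinearMap.id ℝ E + A) (by linarith) fun v => by
    rw [add_apply, ContinuousLinearMap.id_apply, inner_add_left, real_inner_self_eq_norm_sq]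
    linarith [hA v]

/-! ## §4 The proximal map is differentiable with derivative `(1 + D∇f(prox f x))⁻¹` -/

/-- **THE JACOBIAN OF THE BACKGROUND FIELD.**  `f` convex and differentiable, `∇f` differentiable at `p = prox f x` with derivative `A`,
and `L` the equivalence with `↑L = 1 + A` (§3) ⟹ `HasFDerivAt (prox f) L⁻¹ x` — Mathlib's `HasFDerivAt.of_local_left_inverse` with
the global identity `z + ∇f z = y ↦ prox f y = z` (§1) and the continuity of `prox` (the tree's `continuous_prox`). [folklore] -/
theorem hasFDerivAt_prox (hf : ConvexOn ℝ univ f) (hd : Differentiable ℝ f) {x : E} {A : E →L[ℝ] E}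
    (hA : HasFDerivAt (∇ f) A (prox f x)) {L : E ≃L[ℝ] E} (hL : (L : E →L[ℝ] E) = ContinuousLinearMap.id ℝ E + A) :
    HasFDerivAt (prox f) (L.symm : E →L[ℝ] E) x := by
  have hT : HasFDerivAt (fun z : E => z + ∇ f z) (L : E →L[ℝ] E) (prox f x) := by
    rw [hL]; exact (hasFDerivAt_id _).add hA
  refine HasFDerivAt.of_local_left_inverse (continuous_prox hf).continuousAt hT ?_
  exact Eventually.of_forall fun y => prox_add_gradient_prox hf (hd _)

/-- **THE JACOBIAN, PACKAGED**: `∃ L : E ≃L E` with `↑L = 1 + D∇f(prox f x)`, `HasFDerivAt (prox f) L⁻¹ x` and `‖L⁻¹ w‖ ≤ ‖w‖`. [folklore] -/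
theorem exists_hasFDerivAt_prox (hf : ConvexOn ℝ univ f) (hd : Differentiable ℝ f) {x : E} {A : E →L[ℝ] E}
    (hA : HasFDerivAt (∇ f) A (prox f x)) :
    ∃ L : E ≃L[ℝ] E, (L : E →L[ℝ] E) = ContinuousLinearMap.id ℝ E + A ∧ HasFDerivAt (prox f) (L.symm : E →L[ℝ] E) x ∧
      ∀ w : E, ‖L.symm w‖ ≤ ‖w‖ := by
  obtain ⟨L, hL, hn⟩ := exists_equiv_id_add A (inner_fderivGradient_self_nonneg hf hd hA)
  exact ⟨L, hL, hasFDerivAt_prox hf hd hA hL, hn⟩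

/-- **`‖D prox f (x)‖ ≤ 1`** (`f` convex `C¹` with `∇f` differentiable at `prox f x`). [folklore] -/
theorem norm_fderiv_prox_le_one (hf : ConvexOn ℝ univ f) (hd : Differentiable ℝ f) {x : E} {A : E →L[ℝ] E}
    (hA : HasFDerivAt (∇ f) A (prox f x)) : ‖fderiv ℝ (prox f) x‖ ≤ 1 := by
  obtain ⟨L, -, hD, hn⟩ := exists_hasFDerivAt_prox hf hd hA
  rw [hD.fderiv]
  exact ContinuousLinearMap.opNorm_le_bound _ zero_le_one fun w => by simpa using hn w

/-- **`‖D prox f (x)‖ ≤ (1+m)⁻¹`** when `∇f` is `m`-STRONGLY MONOTONE (`m‖x − y‖² ≤ ⟪∇f x − ∇f y, x − y⟫`, `0 ≤ m` — e.g. `f`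
`m`-strongly convex and `C¹`). [folklore] -/
theorem norm_fderiv_prox_le_of_strong (hf : ConvexOn ℝ univ f) (hd : Differentiable ℝ f) {m : ℝ} (hm : 0 ≤ m)
    (hmono : ∀ x y : E, m * ‖x - y‖ ^ 2 ≤ ⟪∇ f x - ∇ f y, x - y⟫) {x : E} {A : E →L[ℝ] E}
    (hA : HasFDerivAt (∇ f) A (prox f x)) : ‖fderiv ℝ (prox f) x‖ ≤ (1 + m)⁻¹ := by
  obtain ⟨L, hL, hn⟩ := exists_equiv_id_add_of_strong A hm (inner_fderiv_self_ge_of_monotone hmono hA)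
  rw [(hasFDerivAt_prox hf hd hA hL).fderiv]
  exact ContinuousLinearMap.opNorm_le_bound _ (inv_nonneg.mpr (by linarith)) fun w => by simpa using hn w

/-! ## §5 Smoothness: `f ∈ C^{n+1} ⟹ prox f ∈ Cⁿ` -/

/-- **`f ∈ C^{n+2}` CONVEX ⟹ `prox f ∈ C^{n+1}`** (every `n : ℕ∞`; so `f ∈ C^{k+1} ⟹ prox f ∈ Cᵏ` for `k ≥ 1`, and `k = 0` is the tree's
`continuous_prox`).  `z ↦ z + ∇f z` (`C^{n+1}`) and `prox f` (continuous) are inverse to each other (§1), so they form a homeomorphism of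
`E`; its derivative `1 + D∇f(z)` is invertible at every point (§2–§3); Mathlib's `Homeomorph.contDiff_symm`. [folklore] -/
theorem contDiff_prox (hf : ConvexOn ℝ univ f) {n : ℕ∞} (hf2 : ContDiff ℝ ((n : WithTop ℕ∞) + 1 + 1) f) :
    ContDiff ℝ ((n : WithTop ℕ∞) + 1) (prox f) := by
  have hd : Differentiable ℝ f := hf2.differentiable (by simp)
  have hgrad : ContDiff ℝ ((n : WithTop ℕ∞) + 1) (∇ f) :=
    (InnerProductSpace.toDual ℝ E).symm.contDiff.comp (hf2.fderiv_right (m := (n : WithTop ℕ∞) + 1) le_rfl)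
  have hT : ContDiff ℝ ((n : WithTop ℕ∞) + 1) (fun z : E => z + ∇ f z) := contDiff_id.add hgrad
  -- the homeomorphism `z ↦ z + ∇f z` with inverse `prox f`
  let H : E ≃ₜ E :=
    { toFun := fun z => z + ∇ f z
      invFun := prox f
      left_inv := fun z => prox_add_gradient hf (hd z)
      right_inv := fun x => prox_add_gradient_prox hf (hd _)
      continuous_toFun := hT.continuous
      continuous_invFun := continuous_prox hf }
  -- derivative equivalences at every point
  have hgd : ∀ z : E, DifferentiableAt ℝ (∇ f) z := fun z => (hgrad.differentiable (by simp)) z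
  have hex : ∀ z : E, ∃ L : E ≃L[ℝ] E, HasFDerivAt (H : E → E) (L : E →L[ℝ] E) z := fun z => by
    obtain ⟨L, hL, -⟩ := exists_equiv_id_add (fderiv ℝ (∇ f) z)
      (inner_fderivGradient_self_nonneg hf hd (hgd z).hasFDerivAt)
    exact ⟨L, by rw [hL]; exact (hasFDerivAt_id z).add (hgd z).hasFDerivAt⟩
  choose Lz hLz using hex
  have hsymm := H.contDiff_symm (f₀' := Lz) hLz hT
  exact hsymm

/-- The envelope's gradient map `x ↦ x − prox f x` is `C^{n+1}` for `f ∈ C^{n+2}` convex (so the Moreau envelope is `C^{n+2}` — the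
identification `∇e_f = id − prox f` is the sibling `…MoreauEnvelopeLetters.gradient_proxEnv`, not imported here). [folklore] -/
theorem contDiff_id_sub_prox (hf : ConvexOn ℝ univ f) {n : ℕ∞} (hf2 : ContDiff ℝ ((n : WithTop ℕ∞) + 1 + 1) f) :
    ContDiff ℝ ((n : WithTop ℕ∞) + 1) (fun x : E => x - prox f x) :=
  contDiff_id.sub (contDiff_prox hf hf2)

/-! ## §6 The renormalised Hessian `1 − (1 + A)⁻¹` in operator currency -/

omit [FiniteDimensional ℝ E] in
/-- **`1 − L⁻¹ = A ∘ L⁻¹`** for `↑L = 1 + A` (multiply `L ∘ L⁻¹ = 1` out). [folklore] -/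
theorem id_sub_symm_eq_comp (A : E →L[ℝ] E) {L : E ≃L[ℝ] E} (hL : (L : E →L[ℝ] E) = ContinuousLinearMap.id ℝ E + A) :
    ContinuousLinearMap.id ℝ E - (L.symm : E →L[ℝ] E) = A.comp (L.symm : E →L[ℝ] E) := by
  ext w
  have h : L (L.symm w) = w := L.apply_symm_apply w
  have h' : (L : E →L[ℝ] E) (L.symm w) = w := h
  rw [hL, add_apply, ContinuousLinearMap.id_apply] at h'
  simp only [sub_apply, ContinuousLinearMap.id_apply, ContinuousLinearMap.coe_comp, Function.comp_apply,
    ContinuousLinearEquiv.coe_coe]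
  have : A (L.symm w) = w - L.symm w := by rw [← h']; abel_nf; rw [h']; abel
  rw [this]

/-- **THE HESSIAN OF THE NEXT ACTION**: `D(x ↦ x − prox f x)(x) = 1 − L⁻¹` with `↑L = 1 + D∇f(prox f x)`. [folklore] -/
theorem hasFDerivAt_id_sub_prox (hf : ConvexOn ℝ univ f) (hd : Differentiable ℝ f) {x : E} {A : E →L[ℝ] E}
    (hA : HasFDerivAt (∇ f) A (prox f x)) {L : E ≃L[ℝ] E} (hL : (L : E →L[ℝ] E) = ContinuousLinearMap.id ℝ E + A) :
    HasFDerivAt (fun y : E => y - prox f y) (ContinuousLinearMap.id ℝ E - (L.symm : E →L[ℝ] E)) x :=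
  (hasFDerivAt_id x).sub (hasFDerivAt_prox hf hd hA hL)

omit [FiniteDimensional ℝ E] in
/-- **UPPER FORM BOUND OF THE RENORMALISED HESSIAN**: `⟪(1 − L⁻¹) w, w⟫ ≤ ‖w‖²` for `↑L = 1 + A` with `A` a positive form
(with `w = v + Av`: `⟪Av, v + Av⟫ ≤ ‖v + Av‖²` iff `0 ≤ ‖v‖² + ⟪Av, v⟫`). [folklore] -/
theorem inner_id_sub_symm_self_le (A : E →L[ℝ] E) (hA : ∀ v : E, 0 ≤ ⟪A v, v⟫) {L : E ≃L[ℝ] E}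
    (hL : (L : E →L[ℝ] E) = ContinuousLinearMap.id ℝ E + A) (w : E) :
    ⟪w - L.symm w, w⟫ ≤ ‖w‖ ^ 2 := by
  set v := L.symm w with hv
  have hw : w = v + A v := by
    have h : (L : E →L[ℝ] E) v = w := by rw [hv]; exact L.apply_symm_apply w
    rw [hL, add_apply, ContinuousLinearMap.id_apply] at h
    exact h.symm
  have e1 : w - v = A v := by rw [hw]; abel
  rw [e1, hw, inner_add_right, norm_add_sq_real, real_inner_comm (A v) v]
  nlinarith [hA v, sq_nonneg ‖v‖, sq_nonneg ‖A v‖, real_inner_self_eq_norm_sq (A v)]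

omit [FiniteDimensional ℝ E] in
/-- **LOWER FORM BOUND OF THE RENORMALISED HESSIAN — RESISTANCES ADD FOR OPERATORS**: if `m‖v‖² ≤ ⟪A v, v⟫` for all `v` (`0 ≤ m`) and
`↑L = 1 + A`, then `(m∕(1+m))‖w‖² ≤ ⟪(1 − L⁻¹) w, w⟫` for every `w` — NO symmetry of `A` asked (with `w = v + Av` the claim reads
`m‖v + Av‖² ≤ (1+m)(⟪Av, v⟫ + ‖Av‖²)`, i.e. `(1 − m)⟪Av,v⟫ + ‖Av‖² ≥ m‖v‖²`, which follows from `⟪Av,v⟫ ≥ m‖v‖²` and Cauchy–Schwarz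
`‖Av‖‖v‖ ≥ ⟪Av, v⟫`). [folklore] -/
theorem inner_id_sub_symm_self_ge (A : E →L[ℝ] E) {m : ℝ} (hm : 0 ≤ m) (hA : ∀ v : E, m * ‖v‖ ^ 2 ≤ ⟪A v, v⟫) {L : E ≃L[ℝ] E}
    (hL : (L : E →L[ℝ] E) = ContinuousLinearMap.id ℝ E + A) (w : E) :
    m / (1 + m) * ‖w‖ ^ 2 ≤ ⟪w - L.symm w, w⟫ := by
  have h1m : 0 < 1 + m := by linarith
  set v := L.symm w with hv
  have hw : w = v + A v := by
    have h : (L : E →L[ℝ] E) v = w := by rw [hv]; exact L.apply_symm_apply w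
    rw [hL, add_apply, ContinuousLinearMap.id_apply] at h
    exact h.symm
  have e1 : w - v = A v := by rw [hw]; abel
  -- letters: s = ⟪Av, v⟫, a = ‖Av‖, r = ‖v‖
  have hs := hA v
  have hcs : ⟪A v, v⟫ ≤ ‖A v‖ * ‖v‖ := real_inner_le_norm _ _
  have hAv2 : ⟪A v, A v⟫ = ‖A v‖ ^ 2 := real_inner_self_eq_norm_sq (A v)
  rw [e1, hw, inner_add_right, norm_add_sq_real, real_inner_comm (A v) v, hAv2, div_mul_eq_mul_div, div_le_iff₀ h1m]
  -- goal: m (‖v‖² + 2⟪Av,v⟫ + ‖Av‖²) ≤ (⟪Av,v⟫ + ‖Av‖²)(1+m), i.e. m‖v‖² ≤ (1−m)⟪Av,v⟫ + ‖Av‖²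
  -- from `‖Av‖² ‖v‖² ≥ ⟪Av,v⟫²` and `⟪Av,v⟫ ≥ m‖v‖²`: `(⟪Av,v⟫ − m‖v‖²)(⟪Av,v⟫ + ‖v‖²) ≥ 0`
  have hkey : m * ‖v‖ ^ 2 * ‖v‖ ^ 2 ≤ ((1 - m) * ⟪A v, v⟫ + ‖A v‖ ^ 2) * ‖v‖ ^ 2 := by
    have hsq : ⟪A v, v⟫ ^ 2 ≤ ‖A v‖ ^ 2 * ‖v‖ ^ 2 := by
      have h0 : 0 ≤ ⟪A v, v⟫ := le_trans (by positivity) hs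
      nlinarith [norm_nonneg (A v), norm_nonneg v]
    nlinarith [hs, hsq, sq_nonneg ‖v‖, mul_nonneg hm (sq_nonneg ‖v‖)]
  by_cases hv0 : v = 0
  · simp [hv0]
  · have hvpos : 0 < ‖v‖ ^ 2 := by positivity
    have := le_of_mul_le_mul_right hkey hvpos
    nlinarith [this, hs]

/-! ## §7 Toy: `f = 0` — the hypotheses are inhabited and the Jacobian is the identity -/

/-- `prox 0` has derivative `1⁻¹ = 1` at every point: `∇0 = 0` has derivative `0`, `L = 1`. [folklore] -/
example (x : E) : ∃ L : E ≃L[ℝ] E, (L : E →L[ℝ] E) = ContinuousLinearMap.id ℝ E + 0 ∧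
    HasFDerivAt (prox (fun _ : E => (0 : ℝ))) (L.symm : E →L[ℝ] E) x ∧ ∀ w : E, ‖L.symm w‖ ≤ ‖w‖ := by
  have hf : ConvexOn ℝ univ (fun _ : E => (0 : ℝ)) := convexOn_const 0 convex_univ
  have hd : Differentiable ℝ (fun _ : E => (0 : ℝ)) := differentiable_const 0
  have hg : ∇ (fun _ : E => (0 : ℝ)) = fun _ => 0 := by
    funext z
    have h0 : fderiv ℝ (fun _ : E => (0 : ℝ)) z = 0 := by simp
    rw [gradient, h0, map_zero]
  have hA : HasFDerivAt (∇ (fun _ : E => (0 : ℝ))) (0 : E →L[ℝ] E) (prox (fun _ : E => (0 : ℝ)) x) := by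
    rw [hg]; exact hasFDerivAt_const (0 : E) _
  exact exists_hasFDerivAt_prox hf hd hA

end Summit.QuantumFields.BalabanUV.T4Continuum.NE7b.MoreauProxJacobian
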